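import Summits.Ventures.CertifiedArithmetic.LowPrec.SRHoeffding
import Summits.Ventures.CertifiedArithmetic.LowPrec.SRCertificatesFP4
import Summits.Ventures.CertifiedArithmetic.LowPrec.SRCertificatesFP6FP8
import HarnessLib

/-!
# The exponential SR envelope on the certified formats (transfer `ℚ → ℝ`)

HONEST FRAMING: certified error envelopes and provably optimal rounding/accumulation schemes for
low-precision formats under stated cost models; every table by two implementations; no hardware or
vendor claims.

`SRHoeffding` proves the Azuma–Hoeffding tail for the SR summation chain over `K = ℝ`; the format
value sets and their kernel certificates (`SR.FP4.e2m1`, `SR.Formats.e3m2 …`, pair tables, successor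
certificates) live over `K = ℚ`.  This file transfers the chain along the cast `ℚ → ℝ`: the candidates,
the up-probability, the clamp, one step, the whole backward recursion `accExp`, and the path predicates
`NoSat`/`GapLE` commute with the cast onto the real image `realImage F = F.image (↑)` (the cast is a
strictly monotone field embedding).  Consequently the rational deviation probability computed by
`accExp` obeys the real exponential bound (`prob_dev_ge_le_exp_rat`), and we record the all-input
instances for E2M1 (`G = 2`), E3M2 (`4`), E2M3 (`1/2`), E4M3 (`32`), E5M2 (`8192`):
e.g. SR accumulation of `n` terms into OCP E4M3 without a saturating branch deviates from the exact sum
by `≥ t` with probability `≤ 2 exp(−t²/(512 n))`.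
-/

namespace Summit.Ventures.CertifiedArithmetic.LowPrec.SR

open Literature.ComputerArithmetic.ConnollyHighamMary2021 Finset Real

/-! ### The real image of a rational value set -/

/-- The real image of a rational value set. -/
noncomputable def realImage (F : Finset ℚ) : Finset ℝ := F.image ((↑) : ℚ → ℝ)

/-- Membership in the real image. -/
theorem mem_realImage {F : Finset ℚ} {r : ℝ} : r ∈ realImage F ↔ ∃ q ∈ F, (q : ℝ) = r :=
  Finset.mem_image

/-- A rational is in the real image iff it is in the set. -/
theorem cast_mem_realImage {F : Finset ℚ} {q : ℚ} : (q : ℝ) ∈ realImage F ↔ q ∈ F := by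
  rw [mem_realImage]
  constructor
  · rintro ⟨q', hq', h⟩; rwa [← Rat.cast_injective h]
  · intro hq; exact ⟨q, hq, rfl⟩

/-- The real image is nonempty iff the set is. -/
theorem realImage_nonempty {F : Finset ℚ} : (realImage F).Nonempty ↔ F.Nonempty :=
  Finset.image_nonempty

/-! ### Candidates, probability, clamp -/

/-- `⌊·⌋` commutes with the cast. -/
theorem roundDown_cast (F : Finset ℚ) (x : ℚ) :
    roundDown (realImage F) (x : ℝ) = ((roundDown F x : ℚ) : ℝ) := by
  by_cases h : ∃ y ∈ F, y ≤ x
  · have hR : ∃ y ∈ realImage F, y ≤ (x : ℝ) := by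
      obtain ⟨y, hy, hyx⟩ := h; exact ⟨y, cast_mem_realImage.mpr hy, Rat.cast_le.mpr hyx⟩
    apply le_antisymm
    · obtain ⟨y', hy', hyeq⟩ := mem_realImage.mp (roundDown_mem hR)
      have hle : y' ≤ x := by
        have := roundDown_le (realImage F) (x : ℝ); rw [← hyeq] at this; exact_mod_cast this
      rw [← hyeq]; exact_mod_cast le_roundDown_of_mem hy' hle
    · exact le_roundDown_of_mem (cast_mem_realImage.mpr (roundDown_mem h))
        (by exact_mod_cast roundDown_le F x)
  · have h1 : roundDown F x = x := by
      unfold roundDown; rw [dif_neg]; rintro ⟨y, hy⟩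
      exact h ⟨y, (mem_filter.mp hy).1, (mem_filter.mp hy).2⟩
    have h2 : roundDown (realImage F) (x : ℝ) = x := by
      unfold roundDown; rw [dif_neg]; rintro ⟨y, hy⟩
      obtain ⟨hy1, hy2⟩ := mem_filter.mp hy
      obtain ⟨q, hq, rfl⟩ := mem_realImage.mp hy1
      exact h ⟨q, hq, by exact_mod_cast hy2⟩
    rw [h1, h2]

/-- `⌈·⌉` commutes with the cast. -/
theorem roundUp_cast (F : Finset ℚ) (x : ℚ) :
    roundUp (realImage F) (x : ℝ) = ((roundUp F x : ℚ) : ℝ) := by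
  by_cases h : ∃ y ∈ F, x ≤ y
  · have hR : ∃ y ∈ realImage F, (x : ℝ) ≤ y := by
      obtain ⟨y, hy, hxy⟩ := h; exact ⟨y, cast_mem_realImage.mpr hy, Rat.cast_le.mpr hxy⟩
    apply le_antisymm
    · exact roundUp_le_of_mem (cast_mem_realImage.mpr (roundUp_mem h))
        (by exact_mod_cast le_roundUp F x)
    · obtain ⟨y', hy', hyeq⟩ := mem_realImage.mp (roundUp_mem hR)
      have hle : x ≤ y' := by
        have := le_roundUp (realImage F) (x : ℝ); rw [← hyeq] at this; exact_mod_cast this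
      rw [← hyeq]; exact_mod_cast roundUp_le_of_mem hy' hle
  · have h1 : roundUp F x = x := by
      unfold roundUp; rw [dif_neg]; rintro ⟨y, hy⟩
      exact h ⟨y, (mem_filter.mp hy).1, (mem_filter.mp hy).2⟩
    have h2 : roundUp (realImage F) (x : ℝ) = x := by
      unfold roundUp; rw [dif_neg]; rintro ⟨y, hy⟩
      obtain ⟨hy1, hy2⟩ := mem_filter.mp hy
      obtain ⟨q, hq, rfl⟩ := mem_realImage.mp hy1
      exact h ⟨q, hq, by exact_mod_cast hy2⟩
    rw [h1, h2]

/-- The up-probability commutes with the cast. -/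
theorem probUp_cast (F : Finset ℚ) (x : ℚ) :
    probUp (realImage F) (x : ℝ) = ((probUp F x : ℚ) : ℝ) := by
  unfold probUp; rw [roundDown_cast, roundUp_cast]; push_cast; rfl

/-- `min'` commutes with the cast. -/
theorem min'_cast {F : Finset ℚ} (h : F.Nonempty) (h' : (realImage F).Nonempty) :
    (realImage F).min' h' = ((F.min' h : ℚ) : ℝ) := by
  apply le_antisymm
  · exact Finset.min'_le _ _ (cast_mem_realImage.mpr (F.min'_mem h))
  · refine Finset.le_min' _ _ _ fun y hy => ?_
    obtain ⟨q, hq, rfl⟩ := mem_realImage.mp hy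
    exact_mod_cast F.min'_le q hq

/-- `max'` commutes with the cast. -/
theorem max'_cast {F : Finset ℚ} (h : F.Nonempty) (h' : (realImage F).Nonempty) :
    (realImage F).max' h' = ((F.max' h : ℚ) : ℝ) := by
  apply le_antisymm
  · refine Finset.max'_le _ _ _ fun y hy => ?_
    obtain ⟨q, hq, rfl⟩ := mem_realImage.mp hy
    exact_mod_cast F.le_max' q hq
  · exact Finset.le_max' _ _ (cast_mem_realImage.mpr (F.max'_mem h))

/-- The clamp commutes with the cast. -/
theorem clamp_cast (F : Finset ℚ) (x : ℚ) :
    clamp (realImage F) (x : ℝ) = ((clamp F x : ℚ) : ℝ) := by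
  unfold clamp
  by_cases h : F.Nonempty
  · have h' : (realImage F).Nonempty := realImage_nonempty.mpr h
    rw [dif_pos h, dif_pos h', min'_cast h h', max'_cast h h']; push_cast; rfl
  · have h' : ¬ (realImage F).Nonempty := fun hh => h (realImage_nonempty.mp hh)
    rw [dif_neg h, dif_neg h']

/-- Hull membership is invariant under the cast. -/
theorem inHull_cast (F : Finset ℚ) (x : ℚ) : InHull (realImage F) (x : ℝ) ↔ InHull F x := by
  unfold InHull
  constructor
  · rintro ⟨⟨y, hy, hyx⟩, ⟨z, hz, hxz⟩⟩
    obtain ⟨q, hq, rfl⟩ := mem_realImage.mp hy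
    obtain ⟨r, hr, rfl⟩ := mem_realImage.mp hz
    exact ⟨⟨q, hq, by exact_mod_cast hyx⟩, ⟨r, hr, by exact_mod_cast hxz⟩⟩
  · rintro ⟨⟨y, hy, hyx⟩, ⟨z, hz, hxz⟩⟩
    exact ⟨⟨y, cast_mem_realImage.mpr hy, by exact_mod_cast hyx⟩,
      ⟨z, cast_mem_realImage.mpr hz, by exact_mod_cast hxz⟩⟩

/-- The upper step candidate commutes with the cast. -/
theorem up_cast (F : Finset ℚ) (c : ℚ) : up (realImage F) (c : ℝ) = ((up F c : ℚ) : ℝ) := by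
  unfold up; rw [clamp_cast, roundUp_cast]

/-- The lower step candidate commutes with the cast. -/
theorem dn_cast (F : Finset ℚ) (c : ℚ) : dn (realImage F) (c : ℝ) = ((dn F c : ℚ) : ℝ) := by
  unfold dn; rw [clamp_cast, roundDown_cast]

/-- The step up-probability commutes with the cast. -/
theorem pUp_cast (F : Finset ℚ) (c : ℚ) : pUp (realImage F) (c : ℝ) = ((pUp F c : ℚ) : ℝ) := by
  unfold pUp; rw [clamp_cast, probUp_cast]

/-! ### One step, the recursion, the path predicates -/

/-- One SR step commutes with the cast, for cast-compatible observables. -/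
theorem step_cast (F : Finset ℚ) (c : ℚ) {f : ℚ → ℚ} {g : ℝ → ℝ}
    (hfg : ∀ v : ℚ, g (v : ℝ) = ((f v : ℚ) : ℝ)) :
    step (realImage F) (c : ℝ) g = ((step F c f : ℚ) : ℝ) := by
  unfold step; rw [pUp_cast, up_cast, dn_cast, hfg, hfg]; push_cast; rfl

/-- The backward recursion `accExp` commutes with the cast, for cast-compatible observables. -/
theorem accExp_cast (F : Finset ℚ) :
    ∀ (n : ℕ) (x : ℕ → ℚ) {f : ℚ → ℚ} {g : ℝ → ℝ}, (∀ v : ℚ, g (v : ℝ) = ((f v : ℚ) : ℝ)) →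
      ∀ s : ℚ, accExp (realImage F) (fun i => (x i : ℝ)) n g (s : ℝ) = ((accExp F x n f s : ℚ) : ℝ) := by
  intro n
  induction n with
  | zero => intro x f g hfg s; simp only [accExp]; exact hfg s
  | succ n ih =>
      intro x f g hfg s
      simp only [accExp]
      rw [← Rat.cast_add]
      exact step_cast F (s + x 0) (fun v => ih (fun i => x (i + 1)) hfg v)

/-- `NoSat` is invariant under the cast. -/
theorem noSat_cast (F : Finset ℚ) :
    ∀ (n : ℕ) (x : ℕ → ℚ) (s : ℚ), NoSat (realImage F) (fun i => (x i : ℝ)) n (s : ℝ) ↔ NoSat F x n s := by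
  intro n
  induction n with
  | zero => intro x s; simp [NoSat]
  | succ n ih =>
      intro x s
      simp only [NoSat]
      rw [← Rat.cast_add, inHull_cast, up_cast, dn_cast, ih, ih]

/-- `GapLE` is invariant under the cast. -/
theorem gapLE_cast (F : Finset ℚ) (G : ℚ) :
    ∀ (n : ℕ) (x : ℕ → ℚ) (s : ℚ),
      GapLE (realImage F) (G : ℝ) (fun i => (x i : ℝ)) n (s : ℝ) ↔ GapLE F G x n s := by
  intro n
  induction n with
  | zero => intro x s; simp [GapLE]
  | succ n ih =>
      intro x s
      simp only [GapLE]
      rw [← Rat.cast_add, clamp_cast, roundUp_cast, roundDown_cast, up_cast, dn_cast, ih, ih,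
        ← Rat.cast_sub, Rat.cast_le]

/-- The deviation indicator commutes with the cast. -/
theorem devInd_cast (t a v : ℚ) : devInd (t : ℝ) (a : ℝ) (v : ℝ) = ((devInd t a v : ℚ) : ℝ) := by
  unfold devInd
  rw [← Rat.cast_sub, ← Rat.cast_abs]
  by_cases h : t ≤ |v - a|
  · rw [if_pos h, if_pos (Rat.cast_le.mpr h)]; simp
  · rw [if_neg h, if_neg (fun h' => h (Rat.cast_le.mp h'))]; simp

/-! ### The exponential envelope for rational chains and for the certified formats -/

/-- **Exponential envelope, rational chain.** For a rational value set `F`, rational inputs and start,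
under `NoSat ∧ GapLE G` the (rational, exactly computable) deviation probability satisfies
`P(|ŝₙ − s − ∑ₖ xₖ| ≥ t) ≤ 2 exp(−2t²/(n G²))` for every rational `t > 0`. -/
theorem prob_dev_ge_le_exp_rat (F : Finset ℚ) (G : ℚ) (x : ℕ → ℚ) (n : ℕ) (s : ℚ)
    (h : NoSat F x n s) (hg : GapLE F G x n s) (t : ℚ) (ht : 0 < t) :
    ((accExp F x n (devInd t (s + ∑ i ∈ range n, x i)) s : ℚ) : ℝ)
      ≤ 2 * exp (-2 * (t : ℝ) ^ 2 / (n * (G : ℝ) ^ 2)) := by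
  have hc := accExp_cast F n x (f := devInd t (s + ∑ i ∈ range n, x i))
    (g := devInd (t : ℝ) ((s + ∑ i ∈ range n, x i : ℚ) : ℝ)) (fun v => devInd_cast t _ v) s
  rw [← hc]
  have h' := prob_dev_ge_le_exp (realImage F) (G : ℝ) (fun i => (x i : ℝ)) n (s : ℝ)
    ((noSat_cast F n x s).mpr h) ((gapLE_cast F G n x s).mpr hg) (t : ℝ) (by exact_mod_cast ht)
  have hsum : ((s + ∑ i ∈ range n, x i : ℚ) : ℝ) = (s : ℝ) + ∑ i ∈ range n, ((x i : ℚ) : ℝ) := by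
    push_cast; rfl
  rw [hsum]
  exact h'

/-- **E2M1 (FP4)**: SR accumulation of E2M1 data from `0` without a saturating branch deviates from the
exact sum by `≥ t` with probability `≤ 2 exp(−t²/(2n))` (`G = 2` from the pair table). -/
theorem fp4_prob_dev_ge_le_exp (x : ℕ → ℚ) (hx : ∀ i, x i ∈ FP4.e2m1) (n : ℕ)
    (h : NoSat FP4.e2m1 x n 0) (t : ℚ) (ht : 0 < t) :
    ((accExp FP4.e2m1 x n (devInd t (∑ i ∈ range n, x i)) 0 : ℚ) : ℝ)
      ≤ 2 * exp (-(t : ℝ) ^ 2 / (2 * n)) := by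
  have := prob_dev_ge_le_exp_rat FP4.e2m1 2 x n 0 h (FP4.fp4_gapLE_two x hx n) t ht
  rw [zero_add] at this
  refine this.trans (le_of_eq ?_)
  congr 1; congr 1; push_cast; ring

/-- **E3M2 (FP6)**: for every input stream and start, under `NoSat`,
`P(|ŝₙ − s − ∑xₖ| ≥ t) ≤ 2 exp(−t²/(8n))` (`G = 4` from the successor certificate). -/
theorem e3m2_prob_dev_ge_le_exp (x : ℕ → ℚ) (n : ℕ) (s : ℚ) (h : NoSat Formats.e3m2 x n s)
    (t : ℚ) (ht : 0 < t) :
    ((accExp Formats.e3m2 x n (devInd t (s + ∑ i ∈ range n, x i)) s : ℚ) : ℝ)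
      ≤ 2 * exp (-(t : ℝ) ^ 2 / (8 * n)) := by
  have := prob_dev_ge_le_exp_rat Formats.e3m2 4 x n s h
    (gapLE_of_succ Formats.e3m2_nonempty (G := 4) (by norm_num) Formats.e3m2_succ x n s) t ht
  refine this.trans (le_of_eq ?_)
  congr 1; congr 1; push_cast; ring

/-- **E2M3 (FP6)**: under `NoSat`, `P(|ŝₙ − s − ∑xₖ| ≥ t) ≤ 2 exp(−8t²/n)` (`G = 1/2`). -/
theorem e2m3_prob_dev_ge_le_exp (x : ℕ → ℚ) (n : ℕ) (s : ℚ) (h : NoSat Formats.e2m3 x n s)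
    (t : ℚ) (ht : 0 < t) :
    ((accExp Formats.e2m3 x n (devInd t (s + ∑ i ∈ range n, x i)) s : ℚ) : ℝ)
      ≤ 2 * exp (-(8 * (t : ℝ) ^ 2) / n) := by
  have := prob_dev_ge_le_exp_rat Formats.e2m3 (1/2) x n s h
    (gapLE_of_succ Formats.e2m3_nonempty (G := 1/2) (by norm_num) Formats.e2m3_succ x n s) t ht
  refine this.trans (le_of_eq ?_)
  congr 1; congr 1; push_cast; ring

/-- **E4M3 (OCP FP8, saturating at ±448)**: under `NoSat`, `P(|ŝₙ − s − ∑xₖ| ≥ t) ≤ 2 exp(−t²/(512 n))`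
(`G = 32`, the top-binade ulp). -/
theorem e4m3_prob_dev_ge_le_exp (x : ℕ → ℚ) (n : ℕ) (s : ℚ) (h : NoSat Formats.e4m3 x n s)
    (t : ℚ) (ht : 0 < t) :
    ((accExp Formats.e4m3 x n (devInd t (s + ∑ i ∈ range n, x i)) s : ℚ) : ℝ)
      ≤ 2 * exp (-(t : ℝ) ^ 2 / (512 * n)) := by
  have := prob_dev_ge_le_exp_rat Formats.e4m3 32 x n s h
    (gapLE_of_succ Formats.e4m3_nonempty (G := 32) (by norm_num) Formats.e4m3_succ x n s) t ht
  refine this.trans (le_of_eq ?_)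
  congr 1; congr 1; push_cast; ring

/-- **E5M2 (OCP FP8, finite part, saturating at ±57344)**: under `NoSat`,
`P(|ŝₙ − s − ∑xₖ| ≥ t) ≤ 2 exp(−t²/(2²⁵ n))` (`G = 8192`). -/
theorem e5m2_prob_dev_ge_le_exp (x : ℕ → ℚ) (n : ℕ) (s : ℚ) (h : NoSat Formats.e5m2 x n s)
    (t : ℚ) (ht : 0 < t) :
    ((accExp Formats.e5m2 x n (devInd t (s + ∑ i ∈ range n, x i)) s : ℚ) : ℝ)
      ≤ 2 * exp (-(t : ℝ) ^ 2 / (33554432 * n)) := by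
  have := prob_dev_ge_le_exp_rat Formats.e5m2 8192 x n s h
    (gapLE_of_succ Formats.e5m2_nonempty (G := 8192) (by norm_num) Formats.e5m2_succ x n s) t ht
  refine this.trans (le_of_eq ?_)
  congr 1; congr 1; push_cast; ring

end Summit.Ventures.CertifiedArithmetic.LowPrec.SR
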